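import Mathlib.Analysis.Complex.Schwarz
import Literature.MathematicalPhysics.QuantumFieldTheory.Balaban1983to89.B13RealSliceEntryLetters
import Literature.MathematicalPhysics.QuantumFieldTheory.Balaban1983to89.B13EntryLetterAlgebra

/-!
# `Balaban1983to89.B13AccretiveOfRealCoercive` — T. Bałaban, *Propagators for lattice gauge theories in a background field*, Commun. Math.
Phys. **99** (1985) 389–434 [Balaban1985BackgroundPropagators], Thm 3.4 p. 400 («In fact we prove quantitative statements which are more precise,
describing these analytic extensions as small perturbations of the operators depending on U only»), Sect. B (3.62)–(3.64) p. 402 (the extension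
`G′(U′U)` as a Neumann series around the REAL operator), p. 428 («a positive definite operator C\*Δ_kC with a lower bound γ₀ > 0 independent of k and
U … for C\*Δ_kC with an arbitrary configuration U satisfying (3.35), (3.36) with Mα₀ sufficiently small»); *Renormalization group approach to lattice
gauge field theories. II*, Commun. Math. Phys. **116** (1988) 1–22 [Balaban1988RG2Cluster], p. 15 («For the pair (U′, 0) the operators are symmetric,
and the measure is positive … The general case is handled by a perturbative argument»): THE PERTURBATIVE ACCRETIVITY MARGIN — accretivity of a
holomorphic matrix family on a thin complex ball (or a thin strip around the real configurations) from a REAL coercive reference and a majorant with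
bounded absolute row and column sums, the deviation from the real operator being controlled by the SCHWARZ LEMMA (Mathlib
`Complex.dist_le_div_mul_dist_of_mapsTo_ball`, complex normed spaces); assembled with the landed real-slice road
(`B13RealSliceEntryLetters.rawEntryLetters_inv_of_realSlice`, T-58.3) it gives the junction's entry letters of an inverse family `u ↦ A(u)⁻¹`
with the accretivity hypotheses `hm ∕ hacc` of that road DISCHARGED.

statement-level complex analysis ([folklore] Schwarz lemma) over Mathlib and the landed `B13RealSliceEntryLetters` ∕ `B13Sqrt27Accretive` ∕
`B13EntryLetterAlgebra` theorems, with citation tags; kernel-checked; nothing here is a claim about the Yang–Mills mass gap; nothing of Bałaban's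
operators is constructed or asserted; no node is discharged; count-neutral.

WHY THIS FILE (cell `pub-ymgap`, HUMAN RULING D-0062, Track A node N10 = [B13]; seat `pub-ymgap-dag-n10-c` g12, module 56A; census
`N10-RESIDUAL-CENSUS-v12.md` item 3 «(t-margin)»).  Every real-slice junction of the N10 lineage — `B13RealSliceEntryLetters` §3 (T-58.3),
`B13WalksOfB9FactorsRealSlice` §3–§4, `B13WalksOfB9FactorsReading` §4, `Thm/…N10AtRecord11B13WalksBlockRealSlice`, `Thm/…N10B13KernelTowerWalksRealSlice`,
`Thm/…N10EntryLettersOfN06RecordFace` §2 — DISPLAYS, for an inverse piece `u ↦ A(u)⁻¹` of NODE A's operator, the pair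
`hmA : 0 < m_A`, `hacc : ∀ u ∈ ball 0 R_an, m_A·Σ|w_i|² ≤ Re Σ w̄_i (A(u)w)_i` — an accretivity margin of the COMPLEXIFIED operator on the WHOLE complex
ball.  That is nobody's theorem and not a printed statement: print DERIVES it — the real operator has a lower bound ([B9] p. 428 for C\*Δ_kC, [4] Lemma 2.4;
Thm 3.11 p. 416 for Δ_a, G), and the complex extension is a SMALL PERTURBATION of it ([B9] Thm 3.4 p. 400, Sect. B (3.62)–(3.64); [II] p. 15).  Module 38 §4
`accretive_of_coercive_sub` typed the algebra half (real γ-coercive reference + a deviation with absolute row ∕ column sums ≤ p₀ ⟹ (γ − p₀)-accretive).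
THIS FILE types the analytic half and assembles:
* §0 real-structure trivia: `realStructure_re_zero ∕ _zero_mem ∕ _re_mem ∕ _sub_re ∕ _norm_sub_re`.
* §1 SCHWARZ DEVIATION: ★ `norm_sub_apply_zero_le` (`f : E → F` holomorphic with `‖f‖ ≤ M` on `‖u‖ < R` ⟹ `‖f u − f 0‖ ≤ (2M∕R)·‖u‖`),
  ★ `norm_sub_apply_re_le` (along a real structure `ℛ`: `‖re u‖ + ‖im u‖ < R` ⟹ `‖f u − f (re u)‖ ≤ 2M·‖im u‖∕(R − ‖re u‖)`).
* §2 ACCRETIVITY IN MAJORANT CURRENCY: ★★ `accretive_ball_of_coercive_centre` (entrywise holomorphic `A` with a majorant `‖A(u)_{ij}‖ ≤ M_{ij}` on `‖u‖ < R` whose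
  absolute row and column sums are `≤ S`, `A(0)` real and γ-coercive ⟹ `A(u)` is `(γ − 2S·R′∕R)`-accretive on `‖u‖ < R′`, every `R′ ≤ R`),
  ★★ `accretive_strip_of_realCoercive` (real γ-coercive at EVERY real configuration of the ball ⟹ `(γ − 4S·δ∕R)`-accretive on the strip
  `‖u‖ < R∕2, ‖im u‖ ≤ δ` — the neighbourhood-of-the-real-slice statement), `accretive_ball_of_realCoercive` (ball form from the uniform real hypothesis).
* §3 LETTERS CURRENCY: `rowSum_decay_le` ∕ `colSum_decay_le` (decay majorant `B·e^{−ρd(loc i, loc j)}` + fibre bound `m` + torus row sum `C` ⟹ `S = B·(m·C)`),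
  `rawEntryLetters_of_range_family` (LOCAL holomorphic families — range `r₀` + one uniform bound `a` ⟹ letters `(R, ρ, a·e^{ρ r₀})`: the majorant ask for
  the complexified local operators of (3.23)–(3.26)), ★ `accretive_ball_of_coercive_centre_letters` (+ `_torus`: `C = c₀(1,ρ)^ν` for `ρ > 0`, every torus size).
* §4 ASSEMBLED — T-58.3 WITH `hm ∕ hacc` DISCHARGED: ★★ `rawEntryLetters_inv_of_realCoercive` (inputs: holomorphy + a majorant with row ∕ column sums `S` of the
  UN-inverted family on `‖u‖ < R`; real γ-coercivity at the real configurations; the thin radius `R₁ ≤ R` with `2S·R₁∕R ≤ γ∕2`; real-slice decay of `A(v)⁻¹`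
  on `‖v‖ < R₁`; `0 < r < 1` ⟹ `RawEntryLetters (u ↦ A(u)⁻¹)` on `‖u‖ < (r∕(1+r))R₁` with rate `(1−λ(r))ρ` and constant `B^{1−λ}(max B (4∕γ))^{λ}`),
  ★ `rawEntryLetters_invSqrt_of_realCoercive` (the (2.7) square-root slot, constant `B^{1−λ}(max B (2∕√(γ∕2)))^{λ}`), ★ `rawEntryLetters_inv_of_realCoercive_radii`
  (consumer radius `R₀`, `2R₀ < R₁`, `λ(R₀∕(R₁−R₀)) ≤ (4∕π)R₀∕(R₁−R₀)`).
* §5 NON-VACUITY (A2 ∕ A6): the toy family of module 38 (`A(u) = (γ+u)·1` over the chart `E = ℂ`) inhabits every hypothesis of §4 jointly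
  (`toy_majorant`, `toy_majorant_rowSum ∕ _colSum`, `toy_coercive_real`, ★ `rawEntryLetters_inv_of_realCoercive_toy`), with genuine `u`-dependence.
HONEST FRAMING: the real lower bound (`hcoer`) is print's ([B9] p. 428 ∕ Thm 3.11; N06's lane), the majorant of the complexified operator on the complex ball
is the [II] p. 15 ∕ [I] p. 263 in-edge (N09 ∕ NODE 00); this file only turns «real lower bound + holomorphic small deviation» into the margin.  Nothing of
Bałaban's operators is constructed; N10 NOT discharged; count-neutral; 0 `sorry`; standard axioms; nothing continuum ∕ OS ∕ mass gap ∕ Clay.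

References: T. Bałaban, CMP 99 (1985) 389–434 [Balaban1985BackgroundPropagators] (3.26)–(3.27) p.395, (3.35)–(3.36) p.396, Thm 3.4 p.400, Sect. B
(3.62)–(3.64) p.402, Thm 3.10 (3.107)–(3.108) pp.415–416, Thm 3.11 p.416, Thm 3.12 p.423, p.428; CMP 116 (1988) 1–22 [Balaban1988RG2Cluster] (2.5)–(2.7)
pp.12–13, p.15, (2.16) p.16; CMP 109 (1987) 249–301 [Balaban1987RG1] (1.13)–(1.14) p.262, p.263; CMP 96 (1984) 223–250 [Balaban1984PropagatorsII] Lemma 2.1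
(2.61) p.234, Lemma 2.4; T. Ransford, *Potential Theory in the Complex Plane* (CUP 1995) Thm 4.3.7 [Ransford1995].
────────────────────────────────────────────────────────────────────────────────────────────────────────────────
-/

noncomputable section

namespace Literature.MathematicalPhysics.QuantumFieldTheory.Balaban1983to89.B13AccretiveOfRealCoercive

open Metric Set Finset
open scoped Matrix
open Literature.MathematicalPhysics.QuantumFieldTheory.Balaban1983to89
open Literature.MathematicalPhysics.QuantumFieldTheory.Balaban1983to89.B9Thm37GlueTorus (tdist1 tdist1_nonneg tdist1_comm tdist1_self)
open Literature.MathematicalPhysics.QuantumFieldTheory.Balaban1983to89.B5TorusCover (UT)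
open Literature.MathematicalPhysics.QuantumFieldTheory.Balaban1983to89.B13EntrywiseWalks (RawEntryLetters)
open Literature.MathematicalPhysics.QuantumFieldTheory.Balaban1983to89.B13Sqrt27Accretive (invSqrt)
open Literature.MathematicalPhysics.QuantumFieldTheory.Balaban1983to89.B13RealSliceEntryLetters
  (RealStructure lam lam_radii_le rawEntryLetters_inv_of_realSlice rawEntryLetters_invSqrt_of_realSlice accretive_of_coercive_sub
    realStructureComplex toyFamily toy_holo toy_realSlice)
open Literature.MathematicalPhysics.QuantumFieldTheory.Balaban1983to89.B13EntryLetterAlgebra (sum_fiber_le)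
open Literature.MathematicalPhysics.QuantumFieldTheory.Balaban1983to89.B13LocalKernelWalks (rowSum_torus)

variable {ν : ℕ} {Nf : Fin ν → ℕ} [∀ i, NeZero (Nf i)]
variable {E : Type*} [NormedAddCommGroup E] [NormedSpace ℂ E]
variable {F : Type*} [NormedAddCommGroup F] [NormedSpace ℂ F]
variable {p : Type} [Fintype p] [DecidableEq p]

/-! ## §0. Real-structure trivia -/

omit [NormedSpace ℂ F] in
/-- The real part of `0` is `0` (from `‖re u‖ ≤ ‖u‖`). [folklore] [cite: Ransford1995, Thm. 4.3.7] -/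
theorem realStructure_re_zero (ℛ : RealStructure E) : ℛ.re 0 = 0 :=
  norm_le_zero_iff.1 ((ℛ.norm_re_le 0).trans_eq norm_zero)

/-- `0` is a real configuration (the real line through `0` at parameter `0`). [folklore] [cite: Ransford1995, Thm. 4.3.7] -/
theorem realStructure_zero_mem (ℛ : RealStructure E) : (0 : E) ∈ ℛ.Ereal := by
  have h := ℛ.line 0 0
  have him : ℛ.im 0 = 0 := norm_le_zero_iff.1 ((ℛ.norm_im_le 0).trans_eq norm_zero)
  rwa [realStructure_re_zero, him, smul_zero, add_zero] at h

/-- `re u` is a real configuration. [folklore] [cite: Ransford1995, Thm. 4.3.7] -/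
theorem realStructure_re_mem (ℛ : RealStructure E) (u : E) : ℛ.re u ∈ ℛ.Ereal := by
  have h := ℛ.line u 0
  rwa [Complex.ofReal_zero, zero_smul, add_zero] at h

/-- `u − re u = i·im u`. [folklore] [cite: Ransford1995, Thm. 4.3.7] -/
theorem realStructure_sub_re (ℛ : RealStructure E) (u : E) : u - ℛ.re u = (Complex.I : ℂ) • ℛ.im u := by
  have h := ℛ.decomp u
  calc u - ℛ.re u = (ℛ.re u + (Complex.I : ℂ) • ℛ.im u) - ℛ.re u := by rw [h]
    _ = (Complex.I : ℂ) • ℛ.im u := add_sub_cancel_left _ _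

/-- `‖u − re u‖ = ‖im u‖`. [folklore] [cite: Ransford1995, Thm. 4.3.7] -/
theorem realStructure_norm_sub_re (ℛ : RealStructure E) (u : E) : ‖u - ℛ.re u‖ = ‖ℛ.im u‖ := by
  rw [realStructure_sub_re, norm_smul, Complex.norm_I, one_mul]

/-! ## §1. The Schwarz deviation bounds -/

omit [Fintype p] [DecidableEq p] in
/-- ★ **SCHWARZ DEVIATION FROM THE CENTRE**: `f : E → F` holomorphic on the ball `‖u‖ < R` of a complex normed space with values in a complex
normed space and `‖f‖ ≤ M` there ⟹ `‖f u − f 0‖ ≤ (2M∕R)·‖u‖` on the ball (Schwarz lemma for the map into the closed ball of radius `2M` about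
`f 0`).  The analytic half of [B9] Thm 3.4's «small perturbations of the operators depending on U only».
[cite: Balaban1985BackgroundPropagators, Thm 3.4 p.400, (3.62)-(3.64) p.402] -/
theorem norm_sub_apply_zero_le {f : E → F} {R M : ℝ} (hf : DifferentiableOn ℂ f (ball (0 : E) R))
    (hM : ∀ u ∈ ball (0 : E) R, ‖f u‖ ≤ M) :
    ∀ u ∈ ball (0 : E) R, ‖f u - f 0‖ ≤ 2 * M / R * ‖u‖ := by
  intro u hu
  have hR : 0 < R := by
    have := mem_ball_zero_iff.1 hu
    exact (norm_nonneg u).trans_lt this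
  have h0 : (0 : E) ∈ ball (0 : E) R := mem_ball_self hR
  have hmaps : MapsTo f (ball (0 : E) R) (closedBall (f 0) (2 * M)) := by
    intro w hw
    rw [mem_closedBall, dist_eq_norm]
    calc ‖f w - f 0‖ ≤ ‖f w‖ + ‖f 0‖ := norm_sub_le _ _
      _ ≤ M + M := add_le_add (hM w hw) (hM 0 h0)
      _ = 2 * M := by ring
  have h := Complex.dist_le_div_mul_dist_of_mapsTo_ball hf hmaps hu
  rwa [dist_eq_norm, dist_eq_norm, sub_zero] at h

omit [Fintype p] [DecidableEq p] in
/-- ★ **SCHWARZ DEVIATION FROM THE REAL PART**: along a real structure `ℛ` (`u = re u + i·im u`, `‖re u‖, ‖im u‖ ≤ ‖u‖`): `f` holomorphic with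
`‖f‖ ≤ M` on `‖u‖ < R` and `‖re u‖ + ‖im u‖ < R` ⟹ `‖f u − f (re u)‖ ≤ 2M·‖im u‖∕(R − ‖re u‖)` (Schwarz lemma on the ball of radius `R − ‖re u‖`
about the real configuration `re u`).  [II] p. 15's «perturbative argument» about the real pair `(U′, 0)`.
[cite: Balaban1988RG2Cluster, p.15; Balaban1985BackgroundPropagators, Thm 3.4 p.400] -/
theorem norm_sub_apply_re_le (ℛ : RealStructure E) {f : E → F} {R M : ℝ} (hf : DifferentiableOn ℂ f (ball (0 : E) R))
    (hM : ∀ u ∈ ball (0 : E) R, ‖f u‖ ≤ M) :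
    ∀ u : E, ‖ℛ.re u‖ + ‖ℛ.im u‖ < R → ‖f u - f (ℛ.re u)‖ ≤ 2 * M / (R - ‖ℛ.re u‖) * ‖ℛ.im u‖ := by
  intro u hu
  set v := ℛ.re u with hv
  have hRv : 0 < R - ‖v‖ := by linarith [norm_nonneg (ℛ.im u)]
  have hsub : ball v (R - ‖v‖) ⊆ ball (0 : E) R := by
    intro w hw
    rw [mem_ball, dist_eq_norm] at hw
    rw [mem_ball_zero_iff]
    calc ‖w‖ = ‖(w - v) + v‖ := by rw [sub_add_cancel]
      _ ≤ ‖w - v‖ + ‖v‖ := norm_add_le _ _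
      _ < R - ‖v‖ + ‖v‖ := by linarith
      _ = R := by ring
  have hfv : DifferentiableOn ℂ f (ball v (R - ‖v‖)) := hf.mono hsub
  have hvmem : v ∈ ball v (R - ‖v‖) := mem_ball_self hRv
  have hmaps : MapsTo f (ball v (R - ‖v‖)) (closedBall (f v) (2 * M)) := by
    intro w hw
    rw [mem_closedBall, dist_eq_norm]
    calc ‖f w - f v‖ ≤ ‖f w‖ + ‖f v‖ := norm_sub_le _ _
      _ ≤ M + M := add_le_add (hM w (hsub hw)) (hM v (hsub hvmem))
      _ = 2 * M := by ring
  have humem : u ∈ ball v (R - ‖v‖) := by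
    rw [mem_ball, dist_eq_norm, hv, realStructure_norm_sub_re]
    linarith
  have h := Complex.dist_le_div_mul_dist_of_mapsTo_ball hfv hmaps humem
  rwa [dist_eq_norm, dist_eq_norm, hv, realStructure_norm_sub_re] at h

/-! ## §2. Accretivity on a thin complex ball ∕ strip from a real coercive reference — majorant currency -/

section Majorant

variable {A : E → Matrix p p ℂ} {R R' S γ δ : ℝ} {Mx : p → p → ℝ} {T₀ : Matrix p p ℝ}

omit [Fintype p] [DecidableEq p] in
/-- Entry deviation from the centre: `‖A(u)_{ij} − A(0)_{ij}‖ ≤ 2M_{ij}·R′∕R` on `‖u‖ < R′ ≤ R`. [cite: Balaban1985BackgroundPropagators, Thm 3.4 p.400, (3.62)-(3.64) p.402] -/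
theorem norm_entry_sub_zero_le (hA : ∀ i j, DifferentiableOn ℂ (fun u => A u i j) (ball (0 : E) R))
    (hMx : ∀ u ∈ ball (0 : E) R, ∀ i j, ‖A u i j‖ ≤ Mx i j) (hR'R : R' ≤ R) :
    ∀ u ∈ ball (0 : E) R', ∀ i j, ‖A u i j - A 0 i j‖ ≤ 2 * Mx i j * R' / R := by
  intro u hu i j
  have hu' : ‖u‖ < R' := mem_ball_zero_iff.1 hu
  have huR : u ∈ ball (0 : E) R := mem_ball_zero_iff.2 (hu'.trans_le hR'R)
  have hR : 0 < R := (norm_nonneg u).trans_lt (mem_ball_zero_iff.1 huR)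
  have hM0 : 0 ≤ Mx i j := (norm_nonneg _).trans (hMx u huR i j)
  have h := norm_sub_apply_zero_le (hA i j) (fun w hw => hMx w hw i j) u huR
  calc ‖A u i j - A 0 i j‖ ≤ 2 * Mx i j / R * ‖u‖ := h
    _ ≤ 2 * Mx i j / R * R' := mul_le_mul_of_nonneg_left hu'.le (by positivity)
    _ = 2 * Mx i j * R' / R := by ring

omit [DecidableEq p] in
/-- ★★ **ACCRETIVITY ON A THIN BALL FROM A REAL COERCIVE CENTRE** ([B9] Thm 3.4 p. 400 ∕ Sect. B; [II] p. 15): `A : E → Matrix p p ℂ` entrywise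
holomorphic on `‖u‖ < R` with a majorant `‖A(u)_{ij}‖ ≤ M_{ij}` there whose absolute row and column sums are `≤ S` (`S ≥ 0`); `A(0) = T₀` REAL and
γ-coercive ⟹ for every `R′ ≤ R`, `A(u)` is `(γ − 2S·R′∕R)`-accretive on `‖u‖ < R′`.  (Centre = the real background; `2S·R′∕R` = the row∕column sum of
the Schwarz deviation; module 38 §4 `accretive_of_coercive_sub` does the algebra.)
[cite: Balaban1985BackgroundPropagators, Thm 3.4 p.400, (3.62)-(3.64) p.402, p.428; Balaban1988RG2Cluster, p.15, (2.16) p.16] -/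
theorem accretive_ball_of_coercive_centre (hA : ∀ i j, DifferentiableOn ℂ (fun u => A u i j) (ball (0 : E) R))
    (hMx : ∀ u ∈ ball (0 : E) R, ∀ i j, ‖A u i j‖ ≤ Mx i j)
    (hrow : ∀ i, ∑ j, Mx i j ≤ S) (hcol : ∀ j, ∑ i, Mx i j ≤ S) (hS : 0 ≤ S)
    (h0 : A 0 = T₀.map (algebraMap ℝ ℂ)) (hc : QGQInverse.Coercive T₀ γ) (hR' : 0 ≤ R') (hR'R : R' ≤ R) :
    ∀ u ∈ ball (0 : E) R', ∀ w : p → ℂ,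
      (γ - 2 * S * R' / R) * ∑ i, ‖w i‖ ^ 2 ≤ (∑ i, star (w i) * (A u *ᵥ w) i).re := by
  have hR0 : 0 ≤ R := hR'.trans hR'R
  have hp : 0 ≤ 2 * S * R' / R := by positivity
  have hdev := norm_entry_sub_zero_le hA hMx hR'R
  refine accretive_of_coercive_sub (s := ball (0 : E) R') hc hp (fun u hu i => ?_) (fun u hu j => ?_)
  · calc ∑ j, ‖A u i j - (T₀ i j : ℂ)‖ = ∑ j, ‖A u i j - A 0 i j‖ := by
          refine sum_congr rfl fun j _ => ?_; rw [h0, Matrix.map_apply]; rfl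
      _ ≤ ∑ j, 2 * Mx i j * R' / R := sum_le_sum fun j _ => hdev u hu i j
      _ = 2 * (∑ j, Mx i j) * R' / R := by rw [mul_sum, sum_mul, sum_div]
      _ ≤ 2 * S * R' / R := by
          refine div_le_div_of_nonneg_right ?_ hR0
          exact mul_le_mul_of_nonneg_right (mul_le_mul_of_nonneg_left (hrow i) (by norm_num)) hR'
  · calc ∑ i, ‖A u i j - (T₀ i j : ℂ)‖ = ∑ i, ‖A u i j - A 0 i j‖ := by
          refine sum_congr rfl fun i _ => ?_; rw [h0, Matrix.map_apply]; rfl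
      _ ≤ ∑ i, 2 * Mx i j * R' / R := sum_le_sum fun i _ => hdev u hu i j
      _ = 2 * (∑ i, Mx i j) * R' / R := by rw [mul_sum, sum_mul, sum_div]
      _ ≤ 2 * S * R' / R := by
          refine div_le_div_of_nonneg_right ?_ hR0
          exact mul_le_mul_of_nonneg_right (mul_le_mul_of_nonneg_left (hcol j) (by norm_num)) hR'

omit [Fintype p] [DecidableEq p] in
/-- Entry deviation from the real part on the strip: `‖u‖ < R∕2`, `‖im u‖ ≤ δ` ⟹ `‖A(u)_{ij} − A(re u)_{ij}‖ ≤ 4M_{ij}·δ∕R`. [cite: Balaban1988RG2Cluster, p.15; Balaban1985BackgroundPropagators, Thm 3.4 p.400] -/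
theorem norm_entry_sub_re_le (ℛ : RealStructure E) (hA : ∀ i j, DifferentiableOn ℂ (fun u => A u i j) (ball (0 : E) R))
    (hMx : ∀ u ∈ ball (0 : E) R, ∀ i j, ‖A u i j‖ ≤ Mx i j) :
    ∀ u ∈ ball (0 : E) (R / 2), ‖ℛ.im u‖ ≤ δ → ∀ i j, ‖A u i j - A (ℛ.re u) i j‖ ≤ 4 * Mx i j * δ / R := by
  intro u hu him i j
  have hu' : ‖u‖ < R / 2 := mem_ball_zero_iff.1 hu
  have hR : 0 < R := by linarith [norm_nonneg u]
  have huR : u ∈ ball (0 : E) R := mem_ball_zero_iff.2 (by linarith)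
  have hM0 : 0 ≤ Mx i j := (norm_nonneg _).trans (hMx u huR i j)
  have hre : ‖ℛ.re u‖ < R / 2 := (ℛ.norm_re_le u).trans_lt hu'
  have hsum : ‖ℛ.re u‖ + ‖ℛ.im u‖ < R := by linarith [ℛ.norm_im_le u]
  have h := norm_sub_apply_re_le ℛ (hA i j) (fun w hw => hMx w hw i j) u hsum
  have hden : R / 2 ≤ R - ‖ℛ.re u‖ := by linarith
  calc ‖A u i j - A (ℛ.re u) i j‖ ≤ 2 * Mx i j / (R - ‖ℛ.re u‖) * ‖ℛ.im u‖ := h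
    _ ≤ 2 * Mx i j / (R / 2) * δ :=
        mul_le_mul (div_le_div_of_nonneg_left (by positivity) (by positivity) hden) him (norm_nonneg _) (by positivity)
    _ = 4 * Mx i j * δ / R := by field_simp; ring

omit [DecidableEq p] in
/-- ★★ **ACCRETIVITY ON A STRIP AROUND THE REAL CONFIGURATIONS** ([II] p. 15 «small neighbourhood of the space of real configurations»; [I]
(1.13)–(1.14) p. 262): `A` entrywise holomorphic on `‖u‖ < R` with a majorant whose absolute row and column sums are `≤ S`; at EVERY real configuration
`v` of the ball `A(v)` is a REAL γ-coercive matrix ⟹ `A(u)` is `(γ − 4S·δ∕R)`-accretive at every `u` with `‖u‖ < R∕2` and `‖im u‖ ≤ δ`.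
[cite: Balaban1988RG2Cluster, p.15, (2.16) p.16; Balaban1987RG1, (1.13)-(1.14) p.262; Balaban1985BackgroundPropagators, Thm 3.4 p.400, p.428] -/
theorem accretive_strip_of_realCoercive (ℛ : RealStructure E) (hA : ∀ i j, DifferentiableOn ℂ (fun u => A u i j) (ball (0 : E) R))
    (hMx : ∀ u ∈ ball (0 : E) R, ∀ i j, ‖A u i j‖ ≤ Mx i j)
    (hrow : ∀ i, ∑ j, Mx i j ≤ S) (hcol : ∀ j, ∑ i, Mx i j ≤ S) (hS : 0 ≤ S)
    (hreal : ∀ v ∈ ℛ.Ereal, ‖v‖ < R → ∃ T₀ : Matrix p p ℝ, A v = T₀.map (algebraMap ℝ ℂ) ∧ QGQInverse.Coercive T₀ γ)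
    (hδ : 0 ≤ δ) :
    ∀ u ∈ ball (0 : E) (R / 2), ‖ℛ.im u‖ ≤ δ → ∀ w : p → ℂ,
      (γ - 4 * S * δ / R) * ∑ i, ‖w i‖ ^ 2 ≤ (∑ i, star (w i) * (A u *ᵥ w) i).re := by
  intro u hu him w
  have hu' : ‖u‖ < R / 2 := mem_ball_zero_iff.1 hu
  have hR : 0 < R := by linarith [norm_nonneg u]
  have hp : 0 ≤ 4 * S * δ / R := by positivity
  have hvR : ‖ℛ.re u‖ < R := by linarith [ℛ.norm_re_le u]
  obtain ⟨T₀, hT₀, hc⟩ := hreal (ℛ.re u) (realStructure_re_mem ℛ u) hvR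
  have hdev := norm_entry_sub_re_le ℛ hA hMx u hu him
  refine accretive_of_coercive_sub (s := {u}) hc hp (fun u' hu' i => ?_) (fun u' hu' j => ?_) u (mem_singleton u) w
  · rw [mem_singleton_iff.1 hu']
    calc ∑ j, ‖A u i j - (T₀ i j : ℂ)‖ = ∑ j, ‖A u i j - A (ℛ.re u) i j‖ := by
          refine sum_congr rfl fun j _ => ?_; rw [hT₀, Matrix.map_apply]; rfl
      _ ≤ ∑ j, 4 * Mx i j * δ / R := sum_le_sum fun j _ => hdev i j
      _ = 4 * (∑ j, Mx i j) * δ / R := by rw [mul_sum, sum_mul, sum_div]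
      _ ≤ 4 * S * δ / R := by
          refine div_le_div_of_nonneg_right ?_ hR.le
          exact mul_le_mul_of_nonneg_right (mul_le_mul_of_nonneg_left (hrow i) (by norm_num)) hδ
  · rw [mem_singleton_iff.1 hu']
    calc ∑ i, ‖A u i j - (T₀ i j : ℂ)‖ = ∑ i, ‖A u i j - A (ℛ.re u) i j‖ := by
          refine sum_congr rfl fun i _ => ?_; rw [hT₀, Matrix.map_apply]; rfl
      _ ≤ ∑ i, 4 * Mx i j * δ / R := sum_le_sum fun i _ => hdev i j
      _ = 4 * (∑ i, Mx i j) * δ / R := by rw [mul_sum, sum_mul, sum_div]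
      _ ≤ 4 * S * δ / R := by
          refine div_le_div_of_nonneg_right ?_ hR.le
          exact mul_le_mul_of_nonneg_right (mul_le_mul_of_nonneg_left (hcol j) (by norm_num)) hδ

omit [DecidableEq p] in
/-- **BALL FORM FROM THE UNIFORM REAL HYPOTHESIS** (the junctions' shape): real γ-coercivity at every real configuration of the ball — used at the
real configuration `0` — ⟹ `(γ − 2S·R′∕R)`-accretive on `‖u‖ < R′`, `0 ≤ R′ ≤ R`.
[cite: Balaban1985BackgroundPropagators, Thm 3.4 p.400, p.428; Balaban1988RG2Cluster, p.15] -/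
theorem accretive_ball_of_realCoercive (ℛ : RealStructure E) (hA : ∀ i j, DifferentiableOn ℂ (fun u => A u i j) (ball (0 : E) R))
    (hMx : ∀ u ∈ ball (0 : E) R, ∀ i j, ‖A u i j‖ ≤ Mx i j)
    (hrow : ∀ i, ∑ j, Mx i j ≤ S) (hcol : ∀ j, ∑ i, Mx i j ≤ S) (hS : 0 ≤ S)
    (hreal : ∀ v ∈ ℛ.Ereal, ‖v‖ < R → ∃ T₀ : Matrix p p ℝ, A v = T₀.map (algebraMap ℝ ℂ) ∧ QGQInverse.Coercive T₀ γ)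
    (hR' : 0 < R') (hR'R : R' ≤ R) :
    ∀ u ∈ ball (0 : E) R', ∀ w : p → ℂ,
      (γ - 2 * S * R' / R) * ∑ i, ‖w i‖ ^ 2 ≤ (∑ i, star (w i) * (A u *ᵥ w) i).re := by
  obtain ⟨T₀, hT₀, hc⟩ := hreal 0 (realStructure_zero_mem ℛ) (by rw [norm_zero]; exact hR'.trans_le hR'R)
  exact accretive_ball_of_coercive_centre hA hMx hrow hcol hS hT₀ hc hR'.le hR'R

end Majorant


/-! ## §3. The same in the letters currency of the junctions (`RawEntryLetters`, fibre bound, torus row sum) -/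

section Letters

variable {A : E → Matrix p p ℂ} {loc : p → UT Nf} {R R' ρ B C γ : ℝ} {m : ℕ} {T₀ : Matrix p p ℝ}

omit [DecidableEq p] [NormedAddCommGroup E] [NormedSpace ℂ E] in
/-- Row sums of a decay majorant `B·e^{−ρ d(loc i, loc j)}`: `≤ B·(m·C)` from a fibre bound `m` of the location map and a torus row sum `C` at rate `ρ`
([4] (2.52), (2.61)). [cite: Balaban1984PropagatorsII, (2.52) p.232, Lemma 2.1 (2.61) p.234] -/
theorem rowSum_decay_le (hB : 0 ≤ B) (hfib : ∀ y : UT Nf, (univ.filter fun k => loc k = y).card ≤ m)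
    (hrow : ∀ a : UT Nf, ∑ z : UT Nf, Real.exp (-(ρ * tdist1 Nf a z)) ≤ C) (i : p) :
    ∑ j, B * Real.exp (-(ρ * tdist1 Nf (loc i) (loc j))) ≤ B * (m * C) := by
  rw [← mul_sum]
  refine mul_le_mul_of_nonneg_left ?_ hB
  exact (sum_fiber_le hfib (f := fun y => Real.exp (-(ρ * tdist1 Nf (loc i) y))) fun _ => Real.exp_nonneg _).trans
    (mul_le_mul_of_nonneg_left (hrow (loc i)) (Nat.cast_nonneg _))

omit [DecidableEq p] [NormedAddCommGroup E] [NormedSpace ℂ E] in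
/-- Column sums of the decay majorant (symmetry of the torus distance). [cite: Balaban1984PropagatorsII, (2.52) p.232, Lemma 2.1 (2.61) p.234] -/
theorem colSum_decay_le (hB : 0 ≤ B) (hfib : ∀ y : UT Nf, (univ.filter fun k => loc k = y).card ≤ m)
    (hrow : ∀ a : UT Nf, ∑ z : UT Nf, Real.exp (-(ρ * tdist1 Nf a z)) ≤ C) (j : p) :
    ∑ i, B * Real.exp (-(ρ * tdist1 Nf (loc i) (loc j))) ≤ B * (m * C) := by
  calc ∑ i, B * Real.exp (-(ρ * tdist1 Nf (loc i) (loc j)))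
      = ∑ i, B * Real.exp (-(ρ * tdist1 Nf (loc j) (loc i))) := sum_congr rfl fun i _ => by rw [tdist1_comm]
    _ ≤ B * (m * C) := rowSum_decay_le hB hfib hrow j

omit [Fintype p] [DecidableEq p] in
/-- **LOCAL HOLOMORPHIC FAMILIES HAVE THE LETTERS** (the family version of `B13EntryLetterAlgebra.rawEntryLetters_of_range`): a family `A : E → Matrix`
entrywise holomorphic on `‖u‖ < R` whose entries vanish beyond `d₁`-distance `r₀` of the locations (RANGE `r₀` — the local operators `Δ′_a`, `Δ_U`,
`Q\*aQ` of [B9] (3.23)–(3.26), [II] (2.5)) and are bounded by `a` on the ball has `RawEntryLetters A loc R ρ (a·e^{ρ r₀})` at every rate `ρ ≥ 0` — the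
majorant §2 ∕ §4 ask of the complexified operator, from its range and ONE uniform bound.
[cite: Balaban1985BackgroundPropagators, (3.23)–(3.26) pp.394–395, (3.108) p.416; Balaban1988RG2Cluster, (2.5) p.12, p.15] -/
theorem rawEntryLetters_of_range_family (hA : ∀ i j, DifferentiableOn ℂ (fun u => A u i j) (ball (0 : E) R)) {r₀ a : ℝ}
    (hρ : 0 ≤ ρ) (ha : 0 ≤ a) (hsupp : ∀ u ∈ ball (0 : E) R, ∀ i j, A u i j ≠ 0 → tdist1 Nf (loc i) (loc j) ≤ r₀)
    (hbd : ∀ u ∈ ball (0 : E) R, ∀ i j, ‖A u i j‖ ≤ a) :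
    RawEntryLetters A loc R ρ (a * Real.exp (ρ * r₀)) where
  decay u hu i j := by
    by_cases h0 : A u i j = 0
    · rw [h0, norm_zero]; positivity
    · have hd := hsupp u hu i j h0
      calc ‖A u i j‖ ≤ a * 1 := by rw [mul_one]; exact hbd u hu i j
        _ ≤ a * (Real.exp (ρ * r₀) * Real.exp (-(ρ * tdist1 Nf (loc i) (loc j)))) := by
            refine mul_le_mul_of_nonneg_left ?_ ha
            rw [← Real.exp_add]
            exact Real.one_le_exp (by nlinarith)
        _ = a * Real.exp (ρ * r₀) * Real.exp (-(ρ * tdist1 Nf (loc i) (loc j))) := by ring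
  holo := hA
  B_nonneg := by positivity

omit [DecidableEq p] in
/-- ★ **ACCRETIVITY ON A THIN BALL, LETTERS CURRENCY**: `RawEntryLetters A loc R ρ B` (entrywise (3.108)-decay + holomorphy on `‖u‖ < R`), a fibre
bound `m` of `loc`, a torus row sum `C` at rate `ρ`, `A(0)` real and γ-coercive ⟹ `(γ − 2B(mC)·R′∕R)`-accretive on `‖u‖ < R′`, `0 ≤ R′ ≤ R`.
[cite: Balaban1985BackgroundPropagators, Thm 3.4 p.400, Thm 3.10 (3.108) p.416, p.428; Balaban1984PropagatorsII, Lemma 2.1 (2.61) p.234; Balaban1988RG2Cluster, p.15] -/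
theorem accretive_ball_of_coercive_centre_letters (h : RawEntryLetters A loc R ρ B)
    (hfib : ∀ y : UT Nf, (univ.filter fun k => loc k = y).card ≤ m) (hC : 0 ≤ C)
    (hrow : ∀ a : UT Nf, ∑ z : UT Nf, Real.exp (-(ρ * tdist1 Nf a z)) ≤ C)
    (h0 : A 0 = T₀.map (algebraMap ℝ ℂ)) (hc : QGQInverse.Coercive T₀ γ) (hR' : 0 ≤ R') (hR'R : R' ≤ R) :
    ∀ u ∈ ball (0 : E) R', ∀ w : p → ℂ,
      (γ - 2 * (B * (m * C)) * R' / R) * ∑ i, ‖w i‖ ^ 2 ≤ (∑ i, star (w i) * (A u *ᵥ w) i).re :=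
  accretive_ball_of_coercive_centre h.holo h.decay (rowSum_decay_le h.B_nonneg hfib hrow) (colSum_decay_le h.B_nonneg hfib hrow)
    (mul_nonneg h.B_nonneg (mul_nonneg (Nat.cast_nonneg _) hC)) h0 hc hR' hR'R

omit [DecidableEq p] in
/-- The same with the torus row sum DISCHARGED for every torus size (`rowSum_torus`: `C = c₀(1,ρ)^ν`, `ρ > 0`).
[cite: Balaban1984PropagatorsII, Lemma 2.1 (2.61) p.234; Balaban1985BackgroundPropagators, Thm 3.4 p.400, p.428] -/
theorem accretive_ball_of_coercive_centre_letters_torus (h : RawEntryLetters A loc R ρ B) (hρ : 0 < ρ)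
    (hfib : ∀ y : UT Nf, (univ.filter fun k => loc k = y).card ≤ m)
    (h0 : A 0 = T₀.map (algebraMap ℝ ℂ)) (hc : QGQInverse.Coercive T₀ γ) (hR' : 0 ≤ R') (hR'R : R' ≤ R) :
    ∀ u ∈ ball (0 : E) R', ∀ w : p → ℂ,
      (γ - 2 * (B * (m * B6.c0 1 ρ ^ ν)) * R' / R) * ∑ i, ‖w i‖ ^ 2 ≤ (∑ i, star (w i) * (A u *ᵥ w) i).re :=
  accretive_ball_of_coercive_centre_letters h hfib (pow_nonneg (B6RandomWalk.c0_nonneg 1 ρ) ν) (fun a => rowSum_torus Nf hρ a)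
    h0 hc hR' hR'R

end Letters

/-! ## §4. ASSEMBLED — the real-slice road T-58.3 for the inverse family with `hm ∕ hacc` DISCHARGED -/

section Assembled

variable {A : E → Matrix p p ℂ} {loc : p → UT Nf} {R R₁ R₀ S γ ρ B r : ℝ} {Mx : p → p → ℝ}

/-- ★★ **COMPLEX-BALL ENTRY LETTERS OF `u ↦ A(u)⁻¹` FROM A REAL LOWER BOUND** (= `B13RealSliceEntryLetters.rawEntryLetters_inv_of_realSlice`, T-58.3,
with its accretivity hypotheses `hm ∕ hacc` DISCHARGED by §2): inputs (a) `A` entrywise holomorphic on `‖u‖ < R` with a majorant `M_{ij}` there whose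
absolute row and column sums are `≤ S` ([II] p. 15 ∕ [I] p. 263: the complexified operator on the complex chart — displayed by its owner);
(b′) at every REAL configuration of the ball `A(v)` is a real γ-coercive matrix, `γ > 0` ([B9] p. 428 «lower bound γ₀ > 0 independent of k and U» for
`C\*Δ_kC`; Thm 3.11 p. 416 for `Δ_a`); the thin radius `0 < R₁ ≤ R` with `2S·R₁∕R ≤ γ∕2`; (c) (3.108)-decay of `A(v)⁻¹` at the real configurations of
`‖v‖ < R₁` ([B9] Thm 3.10, print's real regime); `0 < r < 1` ⟹ `RawEntryLetters (u ↦ A(u)⁻¹)` on `‖u‖ < (r∕(1+r))R₁`, rate `(1−λ(r))ρ`, constant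
`B^{1−λ}(max B (4∕γ))^{λ}` (accretivity margin `γ∕2` on `‖u‖ < R₁`).
[cite: Balaban1985BackgroundPropagators, Thm 3.4 p.400, (3.62)-(3.64) p.402, Thm 3.10 (3.108) p.416, Thm 3.11 p.416, p.428; Balaban1988RG2Cluster, (2.7) p.13, p.15;
Balaban1987RG1, (1.13)-(1.14) p.262; Ransford1995, Thm. 4.3.7] -/
theorem rawEntryLetters_inv_of_realCoercive (ℛ : RealStructure E)
    (hA : ∀ i j, DifferentiableOn ℂ (fun u => A u i j) (ball (0 : E) R))
    (hMx : ∀ u ∈ ball (0 : E) R, ∀ i j, ‖A u i j‖ ≤ Mx i j)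
    (hrow : ∀ i, ∑ j, Mx i j ≤ S) (hcol : ∀ j, ∑ i, Mx i j ≤ S) (hS : 0 ≤ S)
    (hreal : ∀ v ∈ ℛ.Ereal, ‖v‖ < R → ∃ T₀ : Matrix p p ℝ, A v = T₀.map (algebraMap ℝ ℂ) ∧ QGQInverse.Coercive T₀ γ)
    (hγ : 0 < γ) (hR₁ : 0 < R₁) (hR₁R : R₁ ≤ R) (hsmall : 2 * S * R₁ / R ≤ γ / 2)
    (hdec : ∀ v ∈ ℛ.Ereal, ‖v‖ < R₁ → ∀ i j, ‖(A v)⁻¹ i j‖ ≤ B * Real.exp (-(ρ * tdist1 Nf (loc i) (loc j))))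
    (hB0 : 0 ≤ B) (hρ : 0 ≤ ρ) (hr0 : 0 < r) (hr1 : r < 1) :
    RawEntryLetters (fun u => (A u)⁻¹) loc (r / (1 + r) * R₁) ((1 - lam r) * ρ)
      (B ^ (1 - lam r) * (max B (4 / γ)) ^ lam r) := by
  have hacc : ∀ u ∈ ball (0 : E) R₁, ∀ w : p → ℂ,
      γ / 2 * ∑ i, ‖w i‖ ^ 2 ≤ (∑ i, star (w i) * (A u *ᵥ w) i).re := by
    intro u hu w
    have h := accretive_ball_of_realCoercive ℛ hA hMx hrow hcol hS hreal hR₁ hR₁R u hu w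
    have hsum : 0 ≤ ∑ i, ‖w i‖ ^ 2 := sum_nonneg fun i _ => by positivity
    have hle : γ / 2 ≤ γ - 2 * S * R₁ / R := by linarith
    exact (mul_le_mul_of_nonneg_right hle hsum).trans h
  have hA₁ : ∀ i j, DifferentiableOn ℂ (fun u => A u i j) (ball (0 : E) R₁) :=
    fun i j => (hA i j).mono (ball_subset_ball hR₁R)
  have key := rawEntryLetters_inv_of_realSlice ℛ (half_pos hγ) hA₁ hacc hdec hB0 hρ hr0 hr1
  have e : (2 : ℝ) / (γ / 2) = 4 / γ := by
    rw [div_div_eq_mul_div]; ring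
  rw [e] at key
  exact key

/-- ★ **THE SQUARE-ROOT SLOT** ((2.7): `Γ = L·P^{−1∕2}`): the same for `u ↦ A(u)^{−1∕2}` (`invSqrt`), constant `B^{1−λ}(max B (2∕√(γ∕2)))^{λ}`.
[cite: Balaban1988RG2Cluster, (2.7) p.13, p.15; Balaban1985BackgroundPropagators, Thm 3.4 p.400, Thm 3.10 (3.108) p.416, p.428; Ransford1995, Thm. 4.3.7] -/
theorem rawEntryLetters_invSqrt_of_realCoercive (ℛ : RealStructure E)
    (hA : ∀ i j, DifferentiableOn ℂ (fun u => A u i j) (ball (0 : E) R))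
    (hMx : ∀ u ∈ ball (0 : E) R, ∀ i j, ‖A u i j‖ ≤ Mx i j)
    (hrow : ∀ i, ∑ j, Mx i j ≤ S) (hcol : ∀ j, ∑ i, Mx i j ≤ S) (hS : 0 ≤ S)
    (hreal : ∀ v ∈ ℛ.Ereal, ‖v‖ < R → ∃ T₀ : Matrix p p ℝ, A v = T₀.map (algebraMap ℝ ℂ) ∧ QGQInverse.Coercive T₀ γ)
    (hγ : 0 < γ) (hR₁ : 0 < R₁) (hR₁R : R₁ ≤ R) (hsmall : 2 * S * R₁ / R ≤ γ / 2)
    (hdec : ∀ v ∈ ℛ.Ereal, ‖v‖ < R₁ → ∀ i j, ‖invSqrt (A v) i j‖ ≤ B * Real.exp (-(ρ * tdist1 Nf (loc i) (loc j))))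
    (hB0 : 0 ≤ B) (hρ : 0 ≤ ρ) (hr0 : 0 < r) (hr1 : r < 1) :
    RawEntryLetters (fun u => invSqrt (A u)) loc (r / (1 + r) * R₁) ((1 - lam r) * ρ)
      (B ^ (1 - lam r) * (max B (2 / Real.sqrt (γ / 2))) ^ lam r) := by
  have hacc : ∀ u ∈ ball (0 : E) R₁, ∀ w : p → ℂ,
      γ / 2 * ∑ i, ‖w i‖ ^ 2 ≤ (∑ i, star (w i) * (A u *ᵥ w) i).re := by
    intro u hu w
    have h := accretive_ball_of_realCoercive ℛ hA hMx hrow hcol hS hreal hR₁ hR₁R u hu w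
    have hsum : 0 ≤ ∑ i, ‖w i‖ ^ 2 := sum_nonneg fun i _ => by positivity
    have hle : γ / 2 ≤ γ - 2 * S * R₁ / R := by linarith
    exact (mul_le_mul_of_nonneg_right hle hsum).trans h
  have hA₁ : ∀ i j, DifferentiableOn ℂ (fun u => A u i j) (ball (0 : E) R₁) :=
    fun i j => (hA i j).mono (ball_subset_ball hR₁R)
  exact rawEntryLetters_invSqrt_of_realSlice ℛ (half_pos hγ) hA₁ hacc hdec hB0 hρ hr0 hr1

/-- ★ **RADII EDITION**: the consumer's radius `R₀ > 0` literally (`rf.R` of the junction), the thin radius `R₁ > 2R₀`, the holomorphy radius `R ≥ R₁`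
([II] p. 15: «much bigger»); rate loss `λ(R₀∕(R₁ − R₀)) ≤ (4∕π)R₀∕(R₁ − R₀)`.
[cite: Balaban1985BackgroundPropagators, Thm 3.4 p.400, Thm 3.10 (3.108) p.416, p.428; Balaban1988RG2Cluster, p.15; Balaban1987RG1, (1.13)-(1.14) p.262; Ransford1995, Thm. 4.3.7] -/
theorem rawEntryLetters_inv_of_realCoercive_radii (ℛ : RealStructure E)
    (hA : ∀ i j, DifferentiableOn ℂ (fun u => A u i j) (ball (0 : E) R))
    (hMx : ∀ u ∈ ball (0 : E) R, ∀ i j, ‖A u i j‖ ≤ Mx i j)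
    (hrow : ∀ i, ∑ j, Mx i j ≤ S) (hcol : ∀ j, ∑ i, Mx i j ≤ S) (hS : 0 ≤ S)
    (hreal : ∀ v ∈ ℛ.Ereal, ‖v‖ < R → ∃ T₀ : Matrix p p ℝ, A v = T₀.map (algebraMap ℝ ℂ) ∧ QGQInverse.Coercive T₀ γ)
    (hγ : 0 < γ) (hR₀ : 0 < R₀) (h2 : 2 * R₀ < R₁) (hR₁R : R₁ ≤ R) (hsmall : 2 * S * R₁ / R ≤ γ / 2)
    (hdec : ∀ v ∈ ℛ.Ereal, ‖v‖ < R₁ → ∀ i j, ‖(A v)⁻¹ i j‖ ≤ B * Real.exp (-(ρ * tdist1 Nf (loc i) (loc j))))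
    (hB0 : 0 ≤ B) (hρ : 0 ≤ ρ) :
    RawEntryLetters (fun u => (A u)⁻¹) loc R₀ ((1 - lam (R₀ / (R₁ - R₀))) * ρ)
        (B ^ (1 - lam (R₀ / (R₁ - R₀))) * (max B (4 / γ)) ^ lam (R₀ / (R₁ - R₀))) ∧
      lam (R₀ / (R₁ - R₀)) ≤ 4 / Real.pi * (R₀ / (R₁ - R₀)) := by
  have hd' : 0 < R₁ - R₀ := by linarith
  have hR₁ : 0 < R₁ := by linarith
  have hr0 : 0 < R₀ / (R₁ - R₀) := div_pos hR₀ hd'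
  have hr1 : R₀ / (R₁ - R₀) < 1 := (div_lt_one hd').2 (by linarith)
  have h := rawEntryLetters_inv_of_realCoercive ℛ hA hMx hrow hcol hS hreal hγ hR₁ hR₁R hsmall hdec hB0 hρ hr0 hr1
  have e : R₀ / (R₁ - R₀) / (1 + R₀ / (R₁ - R₀)) * R₁ = R₀ := by
    field_simp
    ring
  rw [e] at h
  exact ⟨h, lam_radii_le hR₀.le h2⟩

end Assembled

/-! ## §5. NON-VACUITY (A2 ∕ A6): module 38's toy family inhabits every hypothesis of §4 jointly, with genuine `u`-dependence -/

section Toy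

omit [Fintype p] in
/-- The toy majorant on the ball `‖u‖ < γ∕2`: `‖((γ+u)·1)_{ij}‖ ≤ (3γ∕2)·1_{ij}`. [folklore] [cite: Balaban1988RG2Cluster, (2.7) p.13 (toy model, not the paper's operator)] -/
theorem toy_majorant {γ : ℝ} (hγ : 0 < γ) :
    ∀ u ∈ ball (0 : ℂ) (γ / 2), ∀ i j : p, ‖toyFamily (p := p) γ u i j‖ ≤ (3 * γ / 2) * (1 : Matrix p p ℝ) i j := by
  intro u hu i j
  have hu' : ‖u‖ < γ / 2 := mem_ball_zero_iff.1 hu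
  have hsc : ‖(γ : ℂ) + u‖ ≤ 3 * γ / 2 := by
    calc ‖(γ : ℂ) + u‖ ≤ ‖(γ : ℂ)‖ + ‖u‖ := norm_add_le _ _
      _ ≤ γ + γ / 2 := by
          rw [Complex.norm_real, Real.norm_eq_abs, abs_of_pos hγ]; linarith
      _ = 3 * γ / 2 := by ring
  by_cases hij : i = j
  · subst hij
    simp only [toyFamily, Matrix.smul_apply, Matrix.one_apply_eq, smul_eq_mul, mul_one]
    exact hsc
  · simp only [toyFamily, Matrix.smul_apply, Matrix.one_apply_ne hij, smul_zero, norm_zero, mul_zero]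
    exact le_rfl

/-- Row sums of the toy majorant: `Σ_j (3γ∕2)·1_{ij} = 3γ∕2`. [folklore] [cite: Balaban1988RG2Cluster, (2.7) p.13 (toy model)] -/
theorem toy_majorant_rowSum (γ : ℝ) (i : p) : ∑ j, (3 * γ / 2) * (1 : Matrix p p ℝ) i j = 3 * γ / 2 := by
  rw [← mul_sum]
  simp [Matrix.one_apply]

/-- Column sums of the toy majorant. [folklore] [cite: Balaban1988RG2Cluster, (2.7) p.13 (toy model)] -/
theorem toy_majorant_colSum (γ : ℝ) (j : p) : ∑ i, (3 * γ / 2) * (1 : Matrix p p ℝ) i j = 3 * γ / 2 := by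
  rw [← mul_sum]
  simp [Matrix.one_apply]

/-- At every REAL configuration `v = x` of the ball `‖v‖ < γ∕2` the toy family is the REAL matrix `(γ + x)·1`, which is `γ∕2`-coercive.
[folklore] [cite: Balaban1988RG2Cluster, (2.7) p.13 (toy model); Balaban1985BackgroundPropagators, p.428] -/
theorem toy_coercive_real {γ : ℝ} :
    ∀ v ∈ realStructureComplex.Ereal, ‖v‖ < γ / 2 → ∃ T₀ : Matrix p p ℝ,
      toyFamily (p := p) γ v = T₀.map (algebraMap ℝ ℂ) ∧ QGQInverse.Coercive T₀ (γ / 2) := by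
  rintro v ⟨x, rfl⟩ hx
  refine ⟨(γ + x) • (1 : Matrix p p ℝ), ?_, ?_⟩
  · ext i j
    by_cases hij : i = j
    · subst hij; simp [toyFamily, Matrix.one_apply_eq]
    · simp [toyFamily, Matrix.one_apply_ne hij]
  · intro y
    rw [Complex.norm_real, Real.norm_eq_abs] at hx
    have hx' : γ / 2 ≤ γ + x := by linarith [neg_abs_le x]
    rw [Matrix.smul_mulVec, Matrix.one_mulVec, dotProduct_smul, smul_eq_mul]
    exact mul_le_mul_of_nonneg_right hx'
      (by simpa only [dotProduct] using sum_nonneg fun i _ => mul_self_nonneg (y i))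

/-- ★ **§4 FIRES ON A `u`-DEPENDENT FAMILY** (A2 ∕ A6 witness of `rawEntryLetters_inv_of_realCoercive`): the toy covariance `u ↦ ((γ+u)·1)⁻¹` is a
`RawEntryLetters` datum on the thin ball from (a) holomorphy + the majorant `(3γ∕2)·1` (row∕column sums `3γ∕2`) on `‖u‖ < γ∕2`, (b′) REAL
`γ∕2`-coercivity at the real configurations, the thin radius `R₁ = γ∕24` (`2·(3γ∕2)·(γ∕24)∕(γ∕2) = γ∕4`), (c) decay of the inverse on the real axis —
NO accretivity at complex `u` supplied. [folklore] [cite: Balaban1988RG2Cluster, (2.7) p.13 (toy model); Ransford1995, Thm. 4.3.7] -/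
theorem rawEntryLetters_inv_of_realCoercive_toy {γ : ℝ} (hγ : 0 < γ) (loc : p → UT Nf) {ρ r : ℝ} (hρ : 0 ≤ ρ)
    (hr0 : 0 < r) (hr1 : r < 1) :
    RawEntryLetters (fun u => (toyFamily (p := p) γ u)⁻¹) loc (r / (1 + r) * (γ / 24)) ((1 - lam r) * ρ)
      ((2 / γ) ^ (1 - lam r) * (max (2 / γ) (4 / (γ / 2))) ^ lam r) := by
  have hγ2 : 0 < γ / 2 := half_pos hγ
  refine rawEntryLetters_inv_of_realCoercive realStructureComplex (R := γ / 2) (R₁ := γ / 24) (S := 3 * γ / 2)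
    (Mx := fun i j => (3 * γ / 2) * (1 : Matrix p p ℝ) i j)
    (fun i j => toy_holo γ _ i j) (toy_majorant hγ) (fun i => (toy_majorant_rowSum γ i).le)
    (fun j => (toy_majorant_colSum γ j).le) (by positivity) toy_coercive_real hγ2 (by positivity) (by linarith)
    (le_of_eq (by field_simp; ring)) (fun v hv hvR i j => ?_) (div_nonneg (by norm_num) hγ.le) hρ hr0 hr1
  exact toy_realSlice hγ loc v hv (by linarith) i j

end Toy

end Literature.MathematicalPhysics.QuantumFieldTheory.Balaban1983to89.B13AccretiveOfRealCoercive

end
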